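import Mathlib
import Summits.Ventures.HodgeRepro2.T5AdicCompletionNormGroup
import Summits.Ventures.HodgeRepro2.T5AdicCompletionEmbedding
import Summits.Ventures.HodgeRepro2.T5QuadraticBasis
import Summits.Ventures.HodgeRepro2.T5QuadraticGalois
import Summits.Ventures.HodgeRepro2.T5ValuedBallBasis

/-!
# The induced lattice of a quadratic extension of local fields and its principal units

`Kv ⊆ Lw` Mathlib's completions with `[Lw : Kv] = 2`, `σ ≠ 1` the non-trivial automorphism, `θ ∈ O_Lw`
a non-zero anti-invariant element (`σ θ = −θ`), `a = 1 + θ`, so that `(a, σ a) = (1 + θ, 1 − θ)` is a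
NORMAL BASIS of `Lw / Kv`.  The `O_Kv`-lattice `M = O_Kv · a ⊕ O_Kv · σ a` is the INDUCED module
`O_Kv[σ]`, and for a level `γ < 1` of the value group
`lat θ γ = {alg α · a + alg β · σ a | v (alg α) ≤ γ, v (alg β) ≤ γ}` («`ϖ^n M`»),
`principalUnits θ γ = {y ∈ Lwˣ | y − 1 ∈ lat θ γ}` («`1 + ϖ^n M`»).

* `lat` is an additive subgroup, `σ`-stable, contained in the closed ball of radius `γ`, and
  CONTAINS the closed ball of radius `γ / κ` (`mem_lat_of_val_le`), `κ = (v 2 · v 2 · v θ)⁻¹`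
  — the comparison of the two lattices `M ⊇ ϖ^{c} O_Lw`;
* `lat γ · lat γ' ⊆ lat (γ γ' κ)` (`mul_mem_lat`); a `σ`-fixed element of `lat γ` is `alg α · 2`
  with `v (alg α) ≤ γ` (`exists_eq_of_mem_lat_of_fixed`: the fixed part of the induced module is the
  image of the trace).

The principal units `1 + lat γ` (a `σ`-stable open subgroup of `Lwˣ` of finite index in the integer
units) and the one-step approximations behind `Ĥ⁰ = Ĥ⁻¹ = 0` are in `T5InducedLatticeUnits`.

This is Serre, *Local Fields*, Ch. V §3, Lemma 4 / Prop. 7 (the cohomologically trivial open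
subgroup of the units), for the cyclic group of order `2`, at EVERY residue characteristic.

Declaration per README §8(d): «uses an L-value-free non-vanishing device: NO».
-/

namespace Summit.Ventures.HodgeRepro2.T5InducedLattice

open IsDedekindDomain HeightOneSpectrum WithZero

section ValuedTopology

variable {R : Type*} [Ring R] {Γ₀ : Type*} [LinearOrderedCommGroupWithZero Γ₀] [Valued R Γ₀]

/-- A closed ball `{x | v x ≤ γ}` is closed in a valued ring (its complement is open: the valuation
is locally constant off `0`). -/
theorem isClosed_setOf_val_le (γ : Γ₀) : IsClosed {x : R | Valued.v x ≤ γ} := by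
  rw [← isOpen_compl_iff, isOpen_iff_mem_nhds]
  intro x hx
  simp only [Set.mem_compl_iff, Set.mem_setOf_eq, not_le] at hx
  have hx0 : (Valued.v x : Γ₀) ≠ 0 := (lt_of_le_of_lt zero_le hx).ne'
  refine Filter.mem_of_superset (Valued.locally_const hx0) ?_
  intro y hy
  simp only [Set.mem_setOf_eq] at hy
  simp only [Set.mem_compl_iff, Set.mem_setOf_eq, not_le, hy]
  exact hx

end ValuedTopology

section GroupWithZero

variable {Γ₀ : Type*} [LinearOrderedCommGroupWithZero Γ₀]

/-- `a ≤ 1`, `a ≠ 0` ⇒ `1 ≤ a⁻¹`. -/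
theorem one_le_inv_of_le_one {a : Γ₀} (ha : a ≤ 1) (ha0 : a ≠ 0) : 1 ≤ a⁻¹ := by
  rw [one_le_inv₀ (lt_of_le_of_ne zero_le ha0.symm)]
  exact ha

/-- `b ≤ c` and `1 ≤ κ` ⇒ `b ≤ c * κ`. -/
theorem le_mul_of_le_of_one_le {b c κ : Γ₀} (h : b ≤ c) (hκ : 1 ≤ κ) : b ≤ c * κ :=
  h.trans (le_mul_of_one_le_right' hκ)

end GroupWithZero

variable {K : Type*} [Field K] [NumberField K] (v : HeightOneSpectrum (NumberField.RingOfIntegers K))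
  {L : Type*} [Field L] [NumberField L] [Algebra K L]
  (w : HeightOneSpectrum (NumberField.RingOfIntegers L)) [w.asIdeal.LiesOver v.asIdeal]
  (σ : Gal(adicCompletion L w/adicCompletion K v))

/-- The induced lattice at level `γ`: `{alg α · (1 + θ) + alg β · (1 − θ) | v (alg α) ≤ γ, v (alg β) ≤ γ}`
(«`ϖ^n (O_Kv a ⊕ O_Kv σ a)`» with `a = 1 + θ`). -/
def lat (θ : (adicCompletion L w)) (γ : WithZero (Multiplicative ℤ)) : Set (adicCompletion L w) :=
  {z | ∃ α β : (adicCompletion K v), Valued.v ((algebraMap (adicCompletion K v) (adicCompletion L w)) α) ≤ γ ∧ Valued.v ((algebraMap (adicCompletion K v) (adicCompletion L w)) β) ≤ γ ∧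
    z = (algebraMap (adicCompletion K v) (adicCompletion L w)) α * (1 + θ) + (algebraMap (adicCompletion K v) (adicCompletion L w)) β * (1 - θ)}

/-- Membership in `lat`. -/
theorem mem_lat_iff {θ : (adicCompletion L w)} {γ : WithZero (Multiplicative ℤ)} {z : (adicCompletion L w)} :
    z ∈ lat v w θ γ ↔ ∃ α β : (adicCompletion K v), Valued.v ((algebraMap (adicCompletion K v) (adicCompletion L w)) α) ≤ γ ∧ Valued.v ((algebraMap (adicCompletion K v) (adicCompletion L w)) β) ≤ γ ∧
      z = (algebraMap (adicCompletion K v) (adicCompletion L w)) α * (1 + θ) + (algebraMap (adicCompletion K v) (adicCompletion L w)) β * (1 - θ) := Iff.rfl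

/-- `0 ∈ lat`. -/
theorem zero_mem_lat (θ : (adicCompletion L w)) (γ : WithZero (Multiplicative ℤ)) : (0 : (adicCompletion L w)) ∈ lat v w θ γ :=
  ⟨0, 0, by simp, by simp, by simp⟩

/-- `lat` is closed under addition. -/
theorem add_mem_lat {θ : (adicCompletion L w)} {γ : WithZero (Multiplicative ℤ)} {z z' : (adicCompletion L w)} (hz : z ∈ lat v w θ γ)
    (hz' : z' ∈ lat v w θ γ) : z + z' ∈ lat v w θ γ := by
  obtain ⟨α, β, hα, hβ, rfl⟩ := hz
  obtain ⟨α', β', hα', hβ', rfl⟩ := hz'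
  refine ⟨α + α', β + β', ?_, ?_, ?_⟩
  · rw [map_add]; exact (Valuation.map_add _ _ _).trans (max_le hα hα')
  · rw [map_add]; exact (Valuation.map_add _ _ _).trans (max_le hβ hβ')
  · rw [map_add, map_add]; ring

/-- `lat` is closed under negation. -/
theorem neg_mem_lat {θ : (adicCompletion L w)} {γ : WithZero (Multiplicative ℤ)} {z : (adicCompletion L w)} (hz : z ∈ lat v w θ γ) :
    -z ∈ lat v w θ γ := by
  obtain ⟨α, β, hα, hβ, rfl⟩ := hz
  refine ⟨-α, -β, ?_, ?_, ?_⟩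
  · rwa [map_neg, Valuation.map_neg]
  · rwa [map_neg, Valuation.map_neg]
  · rw [map_neg, map_neg]; ring

/-- `lat` is monotone in the level. -/
theorem lat_mono {θ : (adicCompletion L w)} {γ γ' : WithZero (Multiplicative ℤ)} (h : γ ≤ γ') :
    lat v w θ γ ⊆ lat v w θ γ' := by
  rintro z ⟨α, β, hα, hβ, rfl⟩
  exact ⟨α, β, hα.trans h, hβ.trans h, rfl⟩

/-- `lat` as an additive subgroup. -/
def latAddSubgroup (θ : (adicCompletion L w)) (γ : WithZero (Multiplicative ℤ)) : AddSubgroup (adicCompletion L w) where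
  carrier := lat v w θ γ
  add_mem' := add_mem_lat v w
  zero_mem' := zero_mem_lat v w θ γ
  neg_mem' := neg_mem_lat v w

/-- The carrier of `latAddSubgroup`. -/
theorem coe_latAddSubgroup (θ : (adicCompletion L w)) (γ : WithZero (Multiplicative ℤ)) :
    (latAddSubgroup v w θ γ : Set (adicCompletion L w)) = lat v w θ γ := rfl

/-- Elements of `lat θ γ` have valuation `≤ γ` when `θ` is integral. -/
theorem val_le_of_mem_lat {θ : (adicCompletion L w)} (hθ1 : Valued.v θ ≤ 1) {γ : WithZero (Multiplicative ℤ)} {z : (adicCompletion L w)}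
    (hz : z ∈ lat v w θ γ) : Valued.v z ≤ γ := by
  obtain ⟨α, β, hα, hβ, rfl⟩ := hz
  have h1 : Valued.v (1 + θ : (adicCompletion L w)) ≤ 1 :=
    (Valuation.map_add _ _ _).trans (max_le (by simp) hθ1)
  have h2 : Valued.v (1 - θ : (adicCompletion L w)) ≤ 1 :=
    (Valuation.map_sub _ _ _).trans (max_le (by simp) hθ1)
  refine (Valuation.map_add _ _ _).trans (max_le ?_ ?_)
  · rw [map_mul]; exact (mul_le_mul' hα h1).trans (by rw [mul_one])
  · rw [map_mul]; exact (mul_le_mul' hβ h2).trans (by rw [mul_one])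

section Sigma

variable (h2 : Module.finrank (adicCompletion K v) (adicCompletion L w) = 2) (hσ : σ ≠ 1) {θ : (adicCompletion L w)} (hθ : σ θ = -θ)

include hθ in
/-- `lat` is `σ`-stable (`σ` swaps the two basis vectors). -/
theorem algEquiv_mem_lat {γ : WithZero (Multiplicative ℤ)} {z : (adicCompletion L w)} (hz : z ∈ lat v w θ γ) :
    σ z ∈ lat v w θ γ := by
  obtain ⟨α, β, hα, hβ, rfl⟩ := hz
  refine ⟨β, α, hβ, hα, ?_⟩
  rw [map_add, map_mul, map_mul, map_add, map_sub, map_one, hθ, σ.commutes, σ.commutes]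
  ring

include hθ in
/-- A `σ`-fixed element of `lat θ γ` is `alg α · ((1 + θ) + (1 − θ)) = alg α · 2` with
`v (alg α) ≤ γ` (the fixed part of the induced lattice is the image of the trace). -/
theorem exists_eq_of_mem_lat_of_fixed (hθ0 : θ ≠ 0) {γ : WithZero (Multiplicative ℤ)} {z : (adicCompletion L w)}
    (hz : z ∈ lat v w θ γ) (hfix : σ z = z) :
    ∃ α : (adicCompletion K v), Valued.v ((algebraMap (adicCompletion K v) (adicCompletion L w)) α) ≤ γ ∧ z = (algebraMap (adicCompletion K v) (adicCompletion L w)) α * (1 + θ) + (algebraMap (adicCompletion K v) (adicCompletion L w)) α * (1 - θ) := by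
  obtain ⟨α, β, hα, hβ, rfl⟩ := hz
  rw [map_add, map_mul, map_mul, map_add, map_sub, map_one, hθ, σ.commutes, σ.commutes] at hfix
  -- `(alg β − alg α) · (2 θ) = 0`
  have h : ((algebraMap (adicCompletion K v) (adicCompletion L w)) β - (algebraMap (adicCompletion K v) (adicCompletion L w)) α) * (2 * θ) = 0 := by
    have := sub_eq_zero.mpr hfix
    linear_combination this
  rcases mul_eq_zero.mp h with h | h
  · rw [sub_eq_zero] at h
    have hαβ : β = α := (algebraMap (adicCompletion K v) (adicCompletion L w)).injective h
    subst hαβ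
    exact ⟨β, hα, rfl⟩
  · exfalso
    rcases mul_eq_zero.mp h with h | h
    · exact two_ne_zero h
    · exact hθ0 h

end Sigma

section Comparison

variable (h2 : Module.finrank (adicCompletion K v) (adicCompletion L w) = 2) (hσ : σ ≠ 1) {θ : (adicCompletion L w)} (hθ : σ θ = -θ) (hθ0 : θ ≠ 0)
  (hθ1 : Valued.v θ ≤ 1)

/-- The comparison constant `κ = (v (alg 2) · v (alg 2) · v θ)⁻¹`. -/
noncomputable def kappa (θ : (adicCompletion L w)) : WithZero (Multiplicative ℤ) :=
  (Valued.v ((algebraMap (adicCompletion K v) (adicCompletion L w)) (2 : (adicCompletion K v))) * Valued.v ((algebraMap (adicCompletion K v) (adicCompletion L w)) (2 : (adicCompletion K v))) * Valued.v θ)⁻¹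

/-- `v (alg 2) ≠ 0`. -/
theorem val_two_ne_zero : Valued.v ((algebraMap (adicCompletion K v) (adicCompletion L w)) (2 : (adicCompletion K v))) ≠ 0 :=
  (Valuation.ne_zero_iff _).mpr ((map_ne_zero _).mpr two_ne_zero)

/-- `v (alg 2) ≤ 1`. -/
theorem val_two_le_one : Valued.v ((algebraMap (adicCompletion K v) (adicCompletion L w)) (2 : (adicCompletion K v))) ≤ 1 := by
  rw [map_ofNat, ← one_add_one_eq_two]
  exact (Valuation.map_add _ _ _).trans (max_le (by simp) (by simp))

include hθ0 hθ1 in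
/-- `1 ≤ κ`. -/
theorem one_le_kappa : 1 ≤ kappa v w θ := by
  apply one_le_inv_of_le_one
  · calc Valued.v ((algebraMap (adicCompletion K v) (adicCompletion L w)) (2 : (adicCompletion K v))) * Valued.v ((algebraMap (adicCompletion K v) (adicCompletion L w)) (2 : (adicCompletion K v))) * Valued.v θ
        ≤ 1 * 1 * 1 := mul_le_mul' (mul_le_mul' (val_two_le_one v w) (val_two_le_one v w)) hθ1
      _ = 1 := by simp
  · exact mul_ne_zero (mul_ne_zero (val_two_ne_zero v w) (val_two_ne_zero v w))
      ((Valuation.ne_zero_iff _).mpr hθ0)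

include hθ0 hθ1 in
/-- `κ ≠ 0`. -/
theorem kappa_ne_zero : kappa v w θ ≠ 0 :=
  (lt_of_lt_of_le zero_lt_one (one_le_kappa v w hθ0 hθ1)).ne'

include h2 hσ hθ hθ0 hθ1 in
/-- THE LATTICE COMPARISON: the closed ball of radius `γ` lies in `lat θ (γ κ)`
(«`ϖ^{n+c} O_Lw ⊆ ϖ^n M`»): write `z = x + y θ`, then `2 x = z + σ z`, `2 y θ = z − σ z` bound `x` and
`y`, and `α = (x + y) / 2`, `β = (x − y) / 2`. -/
theorem mem_lat_of_val_le {γ : WithZero (Multiplicative ℤ)} {z : (adicCompletion L w)} (hz : Valued.v z ≤ γ) :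
    z ∈ lat v w θ (γ * kappa v w θ) := by
  haveI : FiniteDimensional (adicCompletion K v) (adicCompletion L w) := FiniteDimensional.of_finrank_eq_succ h2
  obtain ⟨x, y, hxy⟩ := T5QuadraticInvolution.exists_eq_add_mul (σ : (adicCompletion L w) →ₐ[(adicCompletion K v)] (adicCompletion L w))
    (T5QuadraticAutomorphism.apply_apply h2 σ hσ)
    (fun t ht => T5QuadraticAutomorphism.mem_range_of_fixed h2 σ hσ ht) hθ hθ0 z
  set two : (adicCompletion K v) := 2 with htwo
  have h2z : (algebraMap (adicCompletion K v) (adicCompletion L w)) two * (algebraMap (adicCompletion K v) (adicCompletion L w)) x = z + σ z := by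
    rw [hxy, map_add, map_mul, hθ, σ.commutes, σ.commutes, htwo, map_ofNat]; ring
  have h2y : (algebraMap (adicCompletion K v) (adicCompletion L w)) two * (algebraMap (adicCompletion K v) (adicCompletion L w)) y * θ = z - σ z := by
    rw [hxy, map_add, map_mul, hθ, σ.commutes, σ.commutes, htwo, map_ofNat]; ring
  have hvσ : Valued.v (σ z) = Valued.v z := T5AdicCompletionGaloisInvariance.val_algEquiv_apply v w σ z
  have hx : Valued.v ((algebraMap (adicCompletion K v) (adicCompletion L w)) x) * Valued.v ((algebraMap (adicCompletion K v) (adicCompletion L w)) two) ≤ γ := by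
    rw [mul_comm, ← map_mul, h2z]
    exact (Valuation.map_add _ _ _).trans (max_le hz (hvσ.le.trans hz))
  have hy : Valued.v ((algebraMap (adicCompletion K v) (adicCompletion L w)) y) * Valued.v ((algebraMap (adicCompletion K v) (adicCompletion L w)) two) * Valued.v θ ≤ γ := by
    rw [mul_comm (Valued.v ((algebraMap (adicCompletion K v) (adicCompletion L w)) y)), ← map_mul, ← map_mul, h2y]
    exact (Valuation.map_sub _ _ _).trans (max_le hz (hvσ.le.trans hz))
  have h2ne : Valued.v ((algebraMap (adicCompletion K v) (adicCompletion L w)) two) ≠ 0 := val_two_ne_zero v w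
  have hθne : Valued.v θ ≠ 0 := (Valuation.ne_zero_iff _).mpr hθ0
  have hinv2 : 1 ≤ (Valued.v ((algebraMap (adicCompletion K v) (adicCompletion L w)) two))⁻¹ := one_le_inv_of_le_one (val_two_le_one v w) h2ne
  have hinvθ : 1 ≤ (Valued.v θ)⁻¹ := one_le_inv_of_le_one hθ1 hθne
  -- bounds on `x` and `y`
  have hx' : Valued.v ((algebraMap (adicCompletion K v) (adicCompletion L w)) x) ≤ γ * (Valued.v ((algebraMap (adicCompletion K v) (adicCompletion L w)) two))⁻¹ := by
    rwa [le_mul_inv_iff₀ (lt_of_le_of_ne zero_le h2ne.symm)]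
  have hy' : Valued.v ((algebraMap (adicCompletion K v) (adicCompletion L w)) y) ≤ γ * (Valued.v ((algebraMap (adicCompletion K v) (adicCompletion L w)) two))⁻¹ * (Valued.v θ)⁻¹ := by
    rw [le_mul_inv_iff₀ (lt_of_le_of_ne zero_le hθne.symm), le_mul_inv_iff₀ (lt_of_le_of_ne zero_le h2ne.symm),
      mul_right_comm]
    exact hy
  have hxy' : max (Valued.v ((algebraMap (adicCompletion K v) (adicCompletion L w)) x)) (Valued.v ((algebraMap (adicCompletion K v) (adicCompletion L w)) y)) ≤
      γ * (Valued.v ((algebraMap (adicCompletion K v) (adicCompletion L w)) two))⁻¹ * (Valued.v θ)⁻¹ :=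
    max_le (le_mul_of_le_of_one_le hx' hinvθ) hy'
  -- the coordinates `α = (x + y) / 2`, `β = (x − y) / 2`
  have hκ : γ * kappa v w θ =
      γ * (Valued.v ((algebraMap (adicCompletion K v) (adicCompletion L w)) two))⁻¹ * (Valued.v θ)⁻¹ * (Valued.v ((algebraMap (adicCompletion K v) (adicCompletion L w)) two))⁻¹ := by
    rw [kappa, mul_inv, mul_inv]; ac_rfl
  refine ⟨(x + y) / two, (x - y) / two, ?_, ?_, ?_⟩
  · rw [map_div₀, Valuation.map_div, hκ, div_eq_mul_inv]
    refine mul_le_mul' ?_ le_rfl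
    rw [map_add]
    exact (Valuation.map_add _ _ _).trans hxy'
  · rw [map_div₀, Valuation.map_div, hκ, div_eq_mul_inv]
    refine mul_le_mul' ?_ le_rfl
    rw [map_sub]
    exact (Valuation.map_sub _ _ _).trans hxy'
  · have h2ne' : ((algebraMap (adicCompletion K v) (adicCompletion L w)) two) ≠ 0 := (map_ne_zero _).mpr two_ne_zero
    rw [hxy, map_div₀, map_div₀, map_add, map_sub]
    field_simp
    rw [htwo, map_ofNat]
    ring

include h2 hσ hθ hθ0 hθ1 in
/-- Products: `lat γ · lat γ' ⊆ lat (γ γ' κ)`. -/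
theorem mul_mem_lat {γ γ' : WithZero (Multiplicative ℤ)} {z z' : (adicCompletion L w)} (hz : z ∈ lat v w θ γ)
    (hz' : z' ∈ lat v w θ γ') : z * z' ∈ lat v w θ (γ * γ' * kappa v w θ) :=
  mem_lat_of_val_le v w σ h2 hσ hθ hθ0 hθ1 (by
    rw [map_mul]; exact mul_le_mul' (val_le_of_mem_lat v w hθ1 hz) (val_le_of_mem_lat v w hθ1 hz'))

end Comparison

end Summit.Ventures.HodgeRepro2.T5InducedLattice
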